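import Mathlib
import Summits.ValiantsHypothesis.ValiantsHypothesis.Theorems.NewtonUnitEquationsNewtonTauWeakVdpDefs

/-!
# `NewtonTauWeak` (stmt-ValiantsHypothesis-5904), line `euler-wronskian-vdp`: vertices of a product

Stub `stub_productVertices` of the lead's skeleton (Ostrowski / KPTT §2 in chart form): given the
vertex-charts statement `hV` (`V(s) ≤ #T₊(s) + #T₋(s)`, where `T_σ(s)` is the set of strict tops of `s`
along the affine chart of weights `(σ, t)`, `t ∈ ℝ`), the Newton polygon of a product of `m` `t`-sparse
bivariate polynomials has at most `2mt + 2` vertices.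

Proof.  If some factor vanishes the product is `0`.  Otherwise, over the domain `ℂ`, the strict top of a
product for a generic weight is the sum of the strict tops of the factors (`isTop_mul`, `isTop_prod`), so
`T_σ(Π f_j)` is the image under summation of the set of realised tuples of tops `(top_t f_j)_j` at generic
times `t`.  Along the chart each component `t ↦ top_t f_j` is a non-returning sequence (interval fibres:
a top at times `t₁ ≤ t₃` is a top at every intermediate time, the defining strict inequalities being
affine in `t`), and a tuple of non-returning sequences with component value sets of sizes `n_j` takes at
most `1 + Σ_j (n_j - 1)` values (`card_image_add_card_le`, induction on the largest time).  Hence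
`#T_σ ≤ 1 + Σ_j (#supp f_j - 1) ≤ mt + 1` per chart and `V ≤ 2mt + 2`.
[KPTT arXiv:1308.2286 §2; Ostrowski; folklore]
-/

-- the namespace mandated for this Theorems file repeats the component `ValiantsHypothesis`
set_option linter.dupNamespace false

noncomputable section

namespace Summit.ValiantsHypothesis.ValiantsHypothesis.Theorems.NewtonUnitEquationsNewtonTauWeak

open scoped BigOperators Polynomial
open MvPolynomial
open Literature.Computability.AlgebraicComplexity (newtonVertexCount)
open Summit.ValiantsHypothesis.ValiantsHypothesis.Theorems.NewtonTauWeakVdp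

namespace ProductVertices

/-! ## Tops of products -/

section Top

variable {R : Type*} [CommSemiring R]

/-- Over a nontrivial semiring, `0` is the strict top of `1` for every weight. [folklore] -/
theorem isTop_one_zero [Nontrivial R] (w : Fin 2 → ℝ) : IsTop w (1 : MvPolynomial (Fin 2) R) 0 := by
  classical
  refine ⟨?_, fun e' he' hne => ?_⟩
  · rw [mem_support_iff, coeff_zero_one]
    exact one_ne_zero
  · exfalso
    rw [← C_1, ← monomial_zero'] at he'
    have h := support_monomial_subset he'
    rw [Finset.mem_singleton] at h
    exact hne h

/-- **Top of a product.** Over a semiring without zero divisors, if `a` is the strict `w`-top of `p`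
and `b` that of `q`, then `a + b` is the strict `w`-top of `p * q`: every other exponent pair of the
supports has strictly smaller weighted degree, so the coefficient of `X^{a+b}` in `p q` is the single
product `coeff a p * coeff b q ≠ 0`. [folklore] -/
theorem isTop_mul [NoZeroDivisors R] {w : Fin 2 → ℝ} {p q : MvPolynomial (Fin 2) R}
    {a b : Fin 2 →₀ ℕ} (hp : IsTop w p a) (hq : IsTop w q b) : IsTop w (p * q) (a + b) := by
  classical
  have key : ∀ x ∈ p.support, ∀ y ∈ q.support, ¬ (x = a ∧ y = b) →
      wdeg w (x + y) < wdeg w (a + b) := by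
    intro x hx y hy hne
    rw [wdeg_add, wdeg_add]
    by_cases hxa : x = a
    · have hyb : y ≠ b := fun h => hne ⟨hxa, h⟩
      rw [hxa]
      exact add_lt_add_right (hq.lt hy hyb) _
    · exact add_lt_add_of_lt_of_le (hp.lt hx hxa) (hq.le hy)
  refine ⟨?_, fun e' he' hne => ?_⟩
  · rw [mem_support_iff, coeff_mul, Finset.sum_eq_single (a, b)]
    · exact mul_ne_zero (mem_support_iff.mp hp.mem) (mem_support_iff.mp hq.mem)
    · rintro ⟨x, y⟩ hxy hne
      rw [Finset.HasAntidiagonal.mem_antidiagonal] at hxy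
      by_contra h
      have hx : x ∈ p.support := mem_support_iff.mpr (left_ne_zero_of_mul h)
      have hy : y ∈ q.support := mem_support_iff.mpr (right_ne_zero_of_mul h)
      have hne' : ¬ (x = a ∧ y = b) := fun hab => hne (by rw [hab.1, hab.2])
      have hlt := key x hx y hy hne'
      dsimp only at hxy
      rw [hxy] at hlt
      exact lt_irrefl _ hlt
    · intro h
      exact (h (by simp)).elim
  · obtain ⟨x, hx, y, hy, rfl⟩ := Finset.mem_add.mp (support_mul p q he')
    exact key x hx y hy fun hab => hne (by rw [hab.1, hab.2])

/-- **Top of a finite product**: over a domain, if `b j` is the strict `w`-top of `f j` for every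
`j ∈ s`, then `Σ_{j ∈ s} b j` is the strict `w`-top of `Π_{j ∈ s} f j`. [folklore] -/
theorem isTop_prod [NoZeroDivisors R] [Nontrivial R] {ι : Type*} (w : Fin 2 → ℝ) (s : Finset ι)
    (f : ι → MvPolynomial (Fin 2) R) (b : ι → (Fin 2 →₀ ℕ)) (h : ∀ j ∈ s, IsTop w (f j) (b j)) :
    IsTop w (∏ j ∈ s, f j) (∑ j ∈ s, b j) := by
  classical
  induction s using Finset.induction_on with
  | empty => simpa using isTop_one_zero w
  | insert a s ha ih =>
    rw [Finset.prod_insert ha, Finset.sum_insert ha]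
    exact isTop_mul (h a (Finset.mem_insert_self a s))
      (ih fun j hj => h j (Finset.mem_insert_of_mem hj))

/-! ## Interval fibres along a chart -/

/-- The weighted degree along the chart `(σ, t)`: `⟨(σ,t), e⟩ = σ e₀ + t e₁`. [folklore] -/
theorem wdeg_chart (σ t : ℝ) (e : Fin 2 →₀ ℕ) :
    wdeg ![σ, t] e = σ * ((e 0 : ℕ) : ℝ) + t * ((e 1 : ℕ) : ℝ) := by
  simp [wdeg]

/-- **Interval fibres.** If `e` is the strict top of `p` for the weights `(σ, t₁)` and `(σ, t₃)` with
`t₁ ≤ t₂ ≤ t₃`, then also for `(σ, t₂)`: the defining strict inequalities are affine in `t`. [folklore] -/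
theorem isTop_chart_of_le_of_le {σ t₁ t₂ t₃ : ℝ} {p : MvPolynomial (Fin 2) R} {e : Fin 2 →₀ ℕ}
    (h₁ : IsTop ![σ, t₁] p e) (h₃ : IsTop ![σ, t₃] p e) (h₁₂ : t₁ ≤ t₂) (h₂₃ : t₂ ≤ t₃) :
    IsTop ![σ, t₂] p e := by
  refine ⟨h₁.mem, fun e' he' hne => ?_⟩
  have a := h₁.lt he' hne
  have b := h₃.lt he' hne
  simp only [wdeg_chart] at a b ⊢
  rcases le_or_gt ((e' 1 : ℕ) : ℝ) ((e 1 : ℕ) : ℝ) with h | h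
  · have hm : (t₂ - t₁) * ((e' 1 : ℕ) : ℝ) ≤ (t₂ - t₁) * ((e 1 : ℕ) : ℝ) :=
      mul_le_mul_of_nonneg_left h (sub_nonneg.mpr h₁₂)
    nlinarith
  · have hm : (t₃ - t₂) * ((e 1 : ℕ) : ℝ) ≤ (t₃ - t₂) * ((e' 1 : ℕ) : ℝ) :=
      mul_le_mul_of_nonneg_left h.le (sub_nonneg.mpr h₂₃)
    nlinarith

end Top

/-! ## Non-returning tuples of sequences -/

/-- **Non-returning tuples.** Let `P : β → ι → α` on a linear order `β` and a nonempty finite set of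
times `T` such that every component `t ↦ P t j` is non-returning on `T` (equal values at `t₁ ≤ t₃`
force the same value at every intermediate `t₂ ∈ T`).  Then the number of realised tuples plus the
number of components is at most `1 +` the total number of realised component values: scanning `T`
upwards, each new tuple brings a NEW value in some component. [folklore] -/
theorem card_image_add_card_le {ι α β : Type*} [LinearOrder β] [Fintype ι] [DecidableEq α]
    [DecidableEq (ι → α)] (P : β → ι → α) (T : Finset β) (hT : T.Nonempty)
    (hP : ∀ j, ∀ t₁ ∈ T, ∀ t₂ ∈ T, ∀ t₃ ∈ T, t₁ ≤ t₂ → t₂ ≤ t₃ → P t₁ j = P t₃ j →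
      P t₂ j = P t₁ j) :
    (T.image P).card + Fintype.card ι ≤ 1 + ∑ j, (T.image fun t => P t j).card := by
  classical
  induction T using Finset.induction_on_max with
  | empty => exact absurd hT Finset.not_nonempty_empty
  | insert a T ha ih =>
    rcases T.eq_empty_or_nonempty with rfl | hne
    · simp
    · have hP' : ∀ j, ∀ t₁ ∈ T, ∀ t₂ ∈ T, ∀ t₃ ∈ T, t₁ ≤ t₂ → t₂ ≤ t₃ → P t₁ j = P t₃ j →
          P t₂ j = P t₁ j := fun j t₁ h₁ t₂ h₂ t₃ h₃ =>
        hP j t₁ (Finset.mem_insert_of_mem h₁) t₂ (Finset.mem_insert_of_mem h₂) t₃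
          (Finset.mem_insert_of_mem h₃)
      have ih' := ih hne hP'
      have hmono : ∀ j, (T.image fun t => P t j).card ≤ ((insert a T).image fun t => P t j).card :=
        fun j => Finset.card_le_card (Finset.image_subset_image (Finset.subset_insert a T))
      have hsum : ∑ j, (T.image fun t => P t j).card ≤
          ∑ j, ((insert a T).image fun t => P t j).card :=
        Finset.sum_le_sum fun j _ => hmono j
      set s' := T.max' hne with hs'
      by_cases heq : P a = P s'
      · have h1 : (insert a T).image P = T.image P := by
          rw [Finset.image_insert, heq]
          exact Finset.insert_eq_of_mem (Finset.mem_image_of_mem _ (T.max'_mem hne))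
        rw [h1]
        omega
      · obtain ⟨j₀, hj₀⟩ : ∃ j, P a j ≠ P s' j := by
          by_contra hcon
          push Not at hcon
          exact heq (funext hcon)
        have hnot : P a j₀ ∉ T.image fun t => P t j₀ := by
          intro hmem
          obtain ⟨r, hr, hr'⟩ := Finset.mem_image.mp hmem
          have h := hP j₀ r (Finset.mem_insert_of_mem hr) s'
            (Finset.mem_insert_of_mem (T.max'_mem hne)) a (Finset.mem_insert_self a T)
            (T.le_max' r hr) (ha s' (T.max'_mem hne)).le hr'
          exact hj₀ (hr'.symm.trans h.symm)
        have hlt : ∑ j, (T.image fun t => P t j).card <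
            ∑ j, ((insert a T).image fun t => P t j).card :=
          Finset.sum_lt_sum (fun j _ => hmono j) ⟨j₀, Finset.mem_univ _, by
            rw [Finset.image_insert, Finset.card_insert_of_notMem hnot]
            exact Nat.lt_succ_self _⟩
        have hle : ((insert a T).image P).card ≤ (T.image P).card + 1 := by
          rw [Finset.image_insert]
          exact Finset.card_insert_le _ _
        omega

/-! ## Counting the chart tops of a product -/

/-- **Chart count for a product.** For nonzero `f_j ∈ ℂ[X,Y]` and any `σ`, the number of strict tops of
`Π_j f_j` realised along the chart of generic weights `(σ, t)`, plus the number of factors, is at most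
`1 + Σ_j #supp f_j`: the top of the product at a generic time is the sum of the tuple of tops of the
factors, and the realised tuples form a non-returning family (`card_image_add_card_le`) whose `j`-th
component takes values in `supp f_j`. [KPTT arXiv:1308.2286 §2; folklore] -/
theorem ncard_chartTops_prod_add_card_le {ι : Type*} [Fintype ι] (σ : ℝ)
    (f : ι → MvPolynomial (Fin 2) ℂ) (hf : ∀ j, f j ≠ 0) :
    {e : Fin 2 →₀ ℕ | ∃ t : ℝ, IsGeneric ![σ, t] ∧ IsTop ![σ, t] (∏ j, f j) e}.ncard +
        Fintype.card ι ≤ 1 + ∑ j, (f j).support.card := by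
  classical
  -- the tops of the factors along the chart (junk at non-generic times)
  have hex : ∀ (t : ℝ) (j : ι), ∃ e : Fin 2 →₀ ℕ, IsGeneric ![σ, t] → IsTop ![σ, t] (f j) e := by
    intro t j
    by_cases hg : IsGeneric ![σ, t]
    · obtain ⟨e, he⟩ := exists_isTop hg (hf j)
      exact ⟨e, fun _ => he⟩
    · exact ⟨0, fun h => absurd h hg⟩
  choose P hP using hex
  -- every support is nonempty
  have hcard : ∀ j, 1 ≤ (f j).support.card := fun j =>
    Finset.card_pos.mpr (Finset.nonempty_iff_ne_empty.mpr fun h => hf j (support_eq_empty.mp h))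
  have hι : Fintype.card ι ≤ ∑ j, (f j).support.card := by
    calc Fintype.card ι = ∑ _j : ι, 1 := by simp
      _ ≤ ∑ j, (f j).support.card := Finset.sum_le_sum fun j _ => hcard j
  -- the chart tops of the product are sums of realised top tuples
  set S := {e : Fin 2 →₀ ℕ | ∃ t : ℝ, IsGeneric ![σ, t] ∧ IsTop ![σ, t] (∏ j, f j) e} with hSdef
  have hS : S ⊆ (fun t => ∑ j, P t j) '' {t | IsGeneric ![σ, t]} := by
    rintro e ⟨t, hgt, he⟩
    exact ⟨t, hgt, (isTop_prod _ Finset.univ f (P t) fun j _ => hP t j hgt).unique he⟩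
  have hfin : S.Finite :=
    (∏ j, f j).support.finite_toSet.subset fun e he => by
      obtain ⟨t, _, he⟩ := he
      exact Finset.mem_coe.mpr he.mem
  -- finitely many generic witness times suffice
  obtain ⟨G, hGsub, hGfin, hSG⟩ :=
    (Set.exists_subset_image_finite_and (f := fun t => ∑ j, P t j) (s := {t | IsGeneric ![σ, t]})
      (p := fun A => S ⊆ A)).mp ⟨S, hS, hfin, subset_rfl⟩
  set T : Finset ℝ := hGfin.toFinset with hTdef
  have hTgen : ∀ t ∈ T, IsGeneric ![σ, t] := fun t ht => hGsub (hGfin.mem_toFinset.mp ht)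
  -- `#S ≤ #` realised tuples at the times `T`
  have hSle : S.ncard ≤ (T.image P).card := by
    calc S.ncard ≤ ((fun t => ∑ j, P t j) '' G).ncard := Set.ncard_le_ncard hSG (hGfin.image _)
      _ = ((T.image fun t => ∑ j, P t j : Finset (Fin 2 →₀ ℕ)) : Set (Fin 2 →₀ ℕ)).ncard := by
          rw [Finset.coe_image, hGfin.coe_toFinset]
      _ = (T.image fun t => ∑ j, P t j).card := Set.ncard_coe_finset _
      _ = ((T.image P).image fun c : ι → (Fin 2 →₀ ℕ) => ∑ j, c j).card := by
          rw [Finset.image_image]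
          rfl
      _ ≤ (T.image P).card := Finset.card_image_le
  -- the realised tuples are non-returning in every component
  have hmain : (T.image P).card + Fintype.card ι ≤ 1 + ∑ j, (f j).support.card := by
    rcases T.eq_empty_or_nonempty with hT | hT
    · rw [hT, Finset.image_empty, Finset.card_empty, zero_add]
      exact hι.trans (Nat.le_add_left _ _)
    · have hnr : ∀ j, ∀ t₁ ∈ T, ∀ t₂ ∈ T, ∀ t₃ ∈ T, t₁ ≤ t₂ → t₂ ≤ t₃ → P t₁ j = P t₃ j →
          P t₂ j = P t₁ j := by
        intro j t₁ h₁ t₂ h₂ t₃ h₃ h₁₂ h₂₃ heq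
        have top₁ := hP t₁ j (hTgen t₁ h₁)
        have top₃ := hP t₃ j (hTgen t₃ h₃)
        rw [← heq] at top₃
        exact (hP t₂ j (hTgen t₂ h₂)).unique (isTop_chart_of_le_of_le top₁ top₃ h₁₂ h₂₃)
      refine (card_image_add_card_le P T hT hnr).trans ?_
      refine Nat.add_le_add_left (Finset.sum_le_sum fun j _ => Finset.card_le_card ?_) 1
      intro c hc
      obtain ⟨t', ht', rfl⟩ := Finset.mem_image.mp hc
      exact (hP t' j (hTgen t' ht')).mem
  calc S.ncard + Fintype.card ι ≤ (T.image P).card + Fintype.card ι := Nat.add_le_add_right hSle _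
    _ ≤ 1 + ∑ j, (f j).support.card := hmain

end ProductVertices

/-- **Ostrowski / KPTT §2, chart form.**  Granted the vertex-charts bound `hV`
(`V(s) ≤ #T₊(s) + #T₋(s)`), the Newton polygon of a product of `m` `t`-sparse bivariate complex
polynomials has at most `2mt + 2` vertices: if a factor vanishes the product is `0`; otherwise along
each chart the strict tops of the product are sums of realised tuples of tops of the factors, of which
there are at most `1 + Σ_j (#supp f_j - 1) ≤ mt + 1`
(`ProductVertices.ncard_chartTops_prod_add_card_le`).
[KPTT arXiv:1308.2286 §2; Ostrowski; folklore] -/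
theorem stub_productVertices
    (hV : ∀ (s : MvPolynomial (Fin 2) ℂ),
      newtonVertexCount s ≤
        {e : Fin 2 →₀ ℕ | ∃ t : ℝ, IsGeneric ![(1 : ℝ), t] ∧ IsTop ![(1 : ℝ), t] s e}.ncard +
          {e : Fin 2 →₀ ℕ | ∃ t : ℝ, IsGeneric ![(-1 : ℝ), t] ∧ IsTop ![(-1 : ℝ), t] s e}.ncard) :
    ∀ (m t : ℕ) (f : Fin m → MvPolynomial (Fin 2) ℂ), (∀ j, (f j).support.card ≤ t) →
      newtonVertexCount (∏ j, f j) ≤ 2 * m * t + 2 := by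
  intro m t f hf
  by_cases hz : ∃ j, f j = 0
  · obtain ⟨j, hj⟩ := hz
    rw [Finset.prod_eq_zero (Finset.mem_univ j) hj, newtonVertexCount_zero]
    exact Nat.zero_le _
  · push Not at hz
    have hsum : ∑ j, (f j).support.card ≤ m * t :=
      (Finset.sum_le_sum fun j _ => hf j).trans (by simp)
    have h₁ := ProductVertices.ncard_chartTops_prod_add_card_le (1 : ℝ) f hz
    have h₂ := ProductVertices.ncard_chartTops_prod_add_card_le (-1 : ℝ) f hz
    rw [Fintype.card_fin] at h₁ h₂
    refine (hV _).trans ?_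
    rw [show 2 * m * t + 2 = 2 * (m * t) + 2 by ring]
    omega

end Summit.ValiantsHypothesis.ValiantsHypothesis.Theorems.NewtonUnitEquationsNewtonTauWeak

end
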